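import Literature.MathematicalPhysics.QuantumFieldTheory.BalabanImbrieJaffe1984to88.BIJ88PolymerRep5134

/-!
# `BalabanImbrieJaffe1984to88.BIJ88Resummation5141Adm` — T. Bałaban, J. Imbrie, A. Jaffe, *Effective action and cluster properties of the
abelian Higgs model*, Commun. Math. Phys. **114** (1988) 257–315 [BalabanImbrieJaffe1988], §5.14 p. 308 [PDF 52], display **(5.14.1)** —
*"To extract the perturbative terms, we resum the decoupling and Mayer expansions in Λ₁₂^{(k)}. … Σ_{{X_α}} Π_α g₂(X_α) = Σ_{{X_α}
overlapping Λ₁₁^{(k)c}} Π_α g₂(X_α) z_F(Λ₁₂^{(k)}) (5.14.1)"* — RE-DERIVED IN THE ADMISSIBLE BOOKKEEPING of (5.13.4) (`BIJ88PolymerRep5134`, GAPS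
G-C2-p25-03): when the fillings `{X_α}` of (5.13.4) range over the CLUSTER CONFIGURATIONS (no two abutting polymers of ≥ 2 cubes — the only
ones the cube-wise decoupling expansion produces), the resummation in Λ₁₂ yields as inner factor the expectation over the fields of Λ₁₂ with
the cubes of Λ₁₂ that ABUT AN INTERPOLATED OUTER POLYMER DECOUPLED (`s_i = 0` there), i.e. `z Λ₁₂ Λ₁₂′` in corner notation, where the print has
the fully coupled `z_F(Λ₁₂) = ⟨…⟩_{1,Λ₁₂}` (`= z Λ₁₂ Λ₁₂`). Companion / correction note to this seat's gen-7 `BIJ88Resummation5141` (p260359),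
whose `eq5141` derived the printed form from the displayed hypothesis `hdec` stated over ALL set partitions.

statement-level skeleton of published theorems with citation tags; proofs where landed; nothing here is a claim about the Yang–Mills mass gap

PDF held: `paper:balaban1988-cmp114-bij-abelian-higgs-effective-action` (journal page = PDF page + 256); p. 306 / p. 308 = PDF 50 / 52 (p. 306
read as image this session; p. 308 read in gen 7, render `original-p052-x2.png` of r16).

**What is proved (0 `sorry`, standard axioms, 0 new `Prop` facts).** Setting of `BIJ88Clusters5134`/`BIJ88PolymerRep5134` (cubes `ι`, abutting
`adj`, corner expectations `z` with `hz : IsClusterFactorizing adj z`, printed activities `g1`, admissible fillings `IsAdmissible`) and of gen-7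
`BIJ88Resummation5141` (large-field cubes `B`, outer families `outer W B` = families of disjoint polymers overlapping `B` covering `W ∩ B`,
`lam12 W ρ = W ∖ ∪ρ` = Λ₁₂, `sum_setPartitions_split`).
* §1 `Cross adj ρ κ` (no polymer of ≥ 2 cubes of `ρ` abuts one of `κ`); **`isAdmissible_union_iff`** (`ρ ∪ κ` admissible iff both are and
  `Cross`).
* §2 `term` (the `Γ`-term of `IsClusterFactorizing.expansion'`), `clusters_filter_subset_eq`/`term_eq_term_mul`/`noIso_iff_of_subset`
  (components of `Γ ⊆ L′ ⊆ L` are the same in `L` and `L′`), **`sum_adm_bigPart_subset`** — THE INNER RESUMMATION: `Σ_{κ admissible filling of L,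
  interpolated cubes ⊆ L′} Π_{X∈κ} g₁(X) = z L′ L′ · Π_{i∈L∖L′} z{i}∅` (bijection with the `Γ ⊆ L′` without isolated cube, zero terms, and
  `expansion'` in `L′`).
* §3 `lam12' adj W ρ` (Λ₁₂′ := the cubes of Λ₁₂ abutting no polymer of ≥ 2 cubes of `ρ`), `cross_iff_bigPart_subset`, **`eq5141_adm`**:
  `Σ_{P admissible filling of W} Π g₁ = Σ_{ρ ∈ outer W B, admissible} (Π_{X∈ρ} g₁ X)·[z Λ₁₂′ Λ₁₂′ · Π_{i∈Λ₁₂∖Λ₁₂′} z{i}∅]`; `inner_eq_corner`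
  (the bracket `= z Λ₁₂ Λ₁₂′`); **`polymerRep_resummed`**: `z W W = Σ_{ρ ∈ outer W B, admissible} (Π_{X∈ρ} g₁ X)·z (lam12 W ρ) (lam12′ W ρ)` —
  (5.13.4) ∘ (5.14.1) for `⟨Π_{i∈W} f(□_i)⟩_1` with honest bookkeeping.

**Reading note (continuation of GAPS G-C2-p25-03).** In print `z_F(Λ₁₂^{(k)}) = ⟨χ′ Π F e^{−Ṽ}⟩_{1,Λ₁₂^{(k)}}` is the FULLY coupled small-field
expectation; the cube-wise decoupling expansion delivers instead the same expectation with the boundary layer Λ₁₂∖Λ₁₂′ (cubes abutting an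
interpolated outer polymer) Dirichlet-decoupled — a located imprecision of the same origin as the range of the fillings in (5.13.4); the
subsequent use of (5.14.1) (normalization `z_F = (z_F/z)e^{log z}`, the local expansion (5.14.2) of `log z`) is insensitive to it in substance
but not in letter. The Mayer part of `g₂` (sum over `S_Y, S_5`, gen 7's `eq5134_exchange`) is not re-threaded here: this file works at fixed
Mayer data with the `g₁` of (5.13.4). NOT summit progress; NOT continuum; NOT Clay. Imports: `BIJ88PolymerRep5134` only; modifies nothing (in
particular NOT gen 7's `BIJ88Resummation5141`, whose theorems remain correct as conditional statements). Cell `lit-balaban` Phase 2, seat p25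
gen 8; rows C2.Eq5.14.1-5.14.2 / C2.Eq5.13.3-5.13.4 (owner r16, referee ref-5).
-/

namespace Literature.MathematicalPhysics.QuantumFieldTheory.BalabanImbrieJaffe1984to88.BIJ88Resummation5141Adm

open Finset
open Literature.Probability.LatticeModels (IsSetPartition setPartitions mem_setPartitions)
open Literature.MathematicalPhysics.QuantumFieldTheory.BalabanImbrieJaffe1984to88.BIJ88Resummation5141
  (Overlaps outer mem_outer lam12 lam12_subset sum_setPartitions_split disjoint_of_outer_of_filling biUnion_subset_of_mem_outer)
open BIJ88Clusters5134 BIJ88PolymerRep5134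

variable {ι : Type*} [DecidableEq ι] (adj : ι → ι → Prop) [DecidableRel adj] {R : Type*} [CommRing R]

/-! ## §1 Admissibility of a glued filling = admissibility of the two parts + no abutting across -/

/-- no polymer of ≥ 2 cubes of `ρ` abuts one of `κ` (in either direction). [cite: BalabanImbrieJaffe1988, (5.14.1) p.308] -/
def Cross (ρ κ : Finset (Finset ι)) : Prop :=
  ∀ X ∈ ρ, ∀ X' ∈ κ, 2 ≤ X.card → 2 ≤ X'.card → ∀ j ∈ X, ∀ j' ∈ X', ¬ adj j j' ∧ ¬ adj j' j

/-- decidability. [cite: BalabanImbrieJaffe1988, (5.14.1) p.308] -/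
instance instDecidableCross (ρ κ : Finset (Finset ι)) : Decidable (Cross adj ρ κ) :=
  inferInstanceAs (Decidable (∀ X ∈ ρ, ∀ X' ∈ κ, 2 ≤ X.card → 2 ≤ X'.card → ∀ j ∈ X, ∀ j' ∈ X', ¬ adj j j' ∧ ¬ adj j' j))

/-- the `Γ`-term of the factorized expansion in the region `X`: `[Π_{K∈clusters(X,Γ), K⊆Γ} a(K)]·Π_{i∈X∖Γ} z{i}∅`.
[cite: BalabanImbrieJaffe1988, (5.13.3) p.305–306] -/
def term (z : Finset ι → Finset ι → R) (X Γ : Finset ι) : R :=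
  (∏ K ∈ (clusters adj X Γ).filter (· ⊆ Γ), act z K) * ∏ i ∈ X \ Γ, z {i} ∅

/-- the cubes of Λ₁₂ NOT abutting an interpolated outer polymer (a polymer of ≥ 2 cubes of the outer family `ρ`): the sub-region of Λ₁₂ on
which the inner decoupling expansion resums to the FULLY COUPLED expectation. [cite: BalabanImbrieJaffe1988, (5.14.1) p.308] -/
def lam12' (W : Finset ι) (ρ : Finset (Finset ι)) : Finset ι :=
  (lam12 W ρ).filter fun i => ∀ j ∈ bigPart ρ, ¬ adj j i ∧ ¬ adj i j

/-- `Λ₁₂′ ⊆ Λ₁₂`. [cite: BalabanImbrieJaffe1988, (5.14.1) p.308] -/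
theorem lam12'_subset (W : Finset ι) (ρ : Finset (Finset ι)) : lam12' adj W ρ ⊆ lam12 W ρ := filter_subset _ _

variable {adj}

omit [DecidableRel adj] in
/-- a glued filling `ρ ∪ κ` (disjoint families) is admissible iff both parts are and no non-singleton polymer of one abuts one of the other.
[cite: BalabanImbrieJaffe1988, (5.14.1) p.308] -/
theorem isAdmissible_union_iff {ρ κ : Finset (Finset ι)} (hd : Disjoint ρ κ) :
    IsAdmissible adj (ρ ∪ κ) ↔ IsAdmissible adj ρ ∧ IsAdmissible adj κ ∧ Cross adj ρ κ := by
  constructor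
  · intro h
    refine ⟨fun X hX X' hX' => h X (mem_union_left _ hX) X' (mem_union_left _ hX'),
      fun X hX X' hX' => h X (mem_union_right _ hX) X' (mem_union_right _ hX'), ?_⟩
    intro X hX X' hX' h2 h2' j hj j' hj'
    have hne : X ≠ X' := fun e => disjoint_left.1 hd hX (e ▸ hX')
    exact ⟨h X (mem_union_left _ hX) X' (mem_union_right _ hX') hne h2 h2' j hj j' hj',
      h X' (mem_union_right _ hX') X (mem_union_left _ hX) hne.symm h2' h2 j' hj' j hj⟩
  · rintro ⟨hρ, hκ, hc⟩ X hX X' hX' hne h2 h2' j hj j' hj'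
    rcases mem_union.1 hX with hX | hX <;> rcases mem_union.1 hX' with hX' | hX'
    · exact hρ X hX X' hX' hne h2 h2' j hj j' hj'
    · exact (hc X hX X' hX' h2 h2' j hj j' hj').1
    · exact (hc X' hX' X hX h2' h2 j' hj' j hj).2
    · exact hκ X hX X' hX' hne h2 h2' j hj j' hj'

/-! ## §2 The inner resummation: admissible fillings of Λ₁₂ whose interpolated cubes avoid a forbidden layer -/

/-- the components of `Γ ⊆ L′ ⊆ L` are the same in `L` and in `L′`. [cite: BalabanImbrieJaffe1988, p.306 (Sect. 5.13)] -/
theorem clusters_filter_subset_eq {L L' Γ : Finset ι} (hL' : L' ⊆ L) (hΓ : Γ ⊆ L') :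
    (clusters adj L Γ).filter (· ⊆ Γ) = (clusters adj L' Γ).filter (· ⊆ Γ) := by
  have hcut : ∀ j ∈ L', ∀ j' ∈ L \ L', j ∈ Γ → j' ∈ Γ → ¬ adj j j' ∧ ¬ adj j' j :=
    fun j _ j' hj' _ hj'Γ => absurd (hΓ hj'Γ) (mem_sdiff.1 hj').2
  have hL : L = L' ∪ (L \ L') := (union_sdiff_of_subset hL').symm
  rw [hL, clusters_union hcut, filter_union]
  have h0 : (clusters adj (L \ L') Γ).filter (· ⊆ Γ) = ∅ := by
    refine filter_eq_empty_iff.2 fun K hK hKΓ => ?_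
    obtain ⟨i, hi⟩ := (isSetPartition_clusters adj (L \ L') Γ).nonempty_of_mem hK
    have hiL : i ∈ L \ L' := (isSetPartition_clusters adj (L \ L') Γ).subset hK hi
    exact (mem_sdiff.1 hiL).2 (hΓ (hKΓ hi))
  rw [h0, union_empty]

/-- … hence the `Γ`-term in `L` is the `Γ`-term in `L′` times the bare expectations of the cubes of `L ∖ L′`.
[cite: BalabanImbrieJaffe1988, p.306 (Sect. 5.13)] -/
theorem term_eq_term_mul {z : Finset ι → Finset ι → R} {L L' Γ : Finset ι} (hL' : L' ⊆ L) (hΓ : Γ ⊆ L') :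
    term adj z L Γ = term adj z L' Γ * ∏ i ∈ L \ L', z {i} ∅ := by
  rw [term, term, clusters_filter_subset_eq hL' hΓ, mul_assoc]
  congr 1
  have hsplit : L \ Γ = (L' \ Γ) ∪ (L \ L') := by
    ext x
    simp only [mem_sdiff, mem_union]
    constructor
    · rintro ⟨hxL, hxΓ⟩
      by_cases hxL' : x ∈ L'
      · exact Or.inl ⟨hxL', hxΓ⟩
      · exact Or.inr ⟨hxL, hxL'⟩
    · rintro (⟨hxL', hxΓ⟩ | ⟨hxL, hxL'⟩)
      · exact ⟨hL' hxL', hxΓ⟩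
      · exact ⟨hxL, fun hxΓ => hxL' (hΓ hxΓ)⟩
  rw [hsplit, prod_union (disjoint_left.2 fun x hx hx' => (mem_sdiff.1 hx').2 (mem_sdiff.1 hx).1)]

/-- isolated interpolated cubes are the same in `L` and `L′`. [cite: BalabanImbrieJaffe1988, p.306 (Sect. 5.13)] -/
theorem noIso_iff_of_subset {L L' Γ : Finset ι} (hL' : L' ⊆ L) (hΓ : Γ ⊆ L') : NoIso adj L Γ ↔ NoIso adj L' Γ := by
  have hcut : ∀ j ∈ L', ∀ j' ∈ L \ L', j ∈ Γ → j' ∈ Γ → ¬ adj j j' ∧ ¬ adj j' j :=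
    fun j _ j' hj' _ hj'Γ => absurd (hΓ hj'Γ) (mem_sdiff.1 hj').2
  have hL : L' ∪ (L \ L') = L := union_sdiff_of_subset hL'
  have key : ∀ i ∈ Γ, cluster adj L Γ i = cluster adj L' Γ i := by
    intro i hi
    rw [← hL]
    exact cluster_union_left hcut (hΓ hi)
  simp only [NoIso]
  exact ⟨fun h i hi => key i hi ▸ h i hi, fun h i hi => (key i hi).symm ▸ h i hi⟩

/-- **the inner resummation** (p. 308 *"we resum the decoupling and Mayer expansions in Λ₁₂^{(k)}"*, in the admissible bookkeeping): for
cluster-factorizing corner data, the sum of `Π g₁` over the admissible fillings `κ` of a region `L` whose interpolated cubes (union of the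
polymers of ≥ 2 cubes) lie in `L′ ⊆ L` is the fully coupled expectation of `L′` times the bare expectations of the cubes of `L ∖ L′`:
`Σ_{κ adm, bigPart κ ⊆ L′} Π_{X∈κ} g₁(X) = z L′ L′ · Π_{i∈L∖L′} z{i}∅`. [cite: BalabanImbrieJaffe1988, (5.14.1) p.308] -/
theorem sum_adm_bigPart_subset {z : Finset ι → Finset ι → R} (hz : IsClusterFactorizing adj z) {L L' : Finset ι} (hL' : L' ⊆ L) :
    ∑ κ ∈ (setPartitions L).filter (fun κ => IsAdmissible adj κ ∧ bigPart κ ⊆ L'), ∏ X ∈ κ, g1 adj z X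
      = z L' L' * ∏ i ∈ L \ L', z {i} ∅ := by
  -- (1) drop the fillings with a disconnected polymer (zero terms)
  have hsplit := (sum_filter_add_sum_filter_not ((setPartitions L).filter (fun κ => IsAdmissible adj κ ∧ bigPart κ ⊆ L'))
    (fun P => ∀ X ∈ P, IsConn adj X) (fun κ => ∏ X ∈ κ, g1 adj z X)).symm
  rw [hsplit]
  have h0 : ∑ P ∈ ((setPartitions L).filter (fun κ => IsAdmissible adj κ ∧ bigPart κ ⊆ L')).filter
      (fun P => ¬ ∀ X ∈ P, IsConn adj X), ∏ X ∈ P, g1 adj z X = 0 := by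
    refine sum_eq_zero fun P hP => ?_
    obtain ⟨hP, hnc⟩ := mem_filter.1 hP
    have hPp : IsSetPartition L P := mem_setPartitions.1 (mem_filter.1 hP).1
    simp only [not_forall] at hnc
    obtain ⟨X, hXP, hX⟩ := hnc
    refine prod_eq_zero hXP ?_
    have h2 : 2 ≤ X.card := by
      by_contra hlt
      have hcard : X.card = 1 := by
        have := (hPp.nonempty_of_mem hXP).card_pos
        omega
      obtain ⟨i, rfl⟩ := card_eq_one.1 hcard
      exact hX (isConn_singleton adj i)
    rw [g1_of_two_le adj z h2, if_neg hX]
  rw [h0, add_zero]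
  -- (2) the bijection with the `Γ ⊆ L′` without isolated cube, (3) add back the zero terms, (4) resum in `L′`
  have step2 : ∑ P ∈ ((setPartitions L).filter (fun κ => IsAdmissible adj κ ∧ bigPart κ ⊆ L')).filter (fun P => ∀ X ∈ P, IsConn adj X),
      ∏ X ∈ P, g1 adj z X = ∑ Γ ∈ L'.powerset.filter (NoIso adj L), term adj z L Γ := by
    symm
    refine sum_nbij' (fun Γ => clusters adj L Γ) (fun P => bigPart P) ?_ ?_ ?_ ?_ ?_
    · intro Γ hΓ
      obtain ⟨hΓ, hno⟩ := mem_filter.1 hΓ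
      have hΓL' : Γ ⊆ L' := mem_powerset.1 hΓ
      simp only [mem_filter, mem_setPartitions]
      refine ⟨⟨isSetPartition_clusters adj L Γ, isAdmissible_clusters L Γ, ?_⟩, fun X hX => isConn_of_mem_clusters hX⟩
      rw [bigPart_clusters (hΓL'.trans hL') hno]
      exact hΓL'
    · intro P hP
      simp only [mem_filter, mem_setPartitions] at hP
      obtain ⟨⟨hPp, -, hbig⟩, hconn⟩ := hP
      exact mem_filter.2 ⟨mem_powerset.2 hbig, noIso_bigPart hPp hconn⟩
    · intro Γ hΓ
      obtain ⟨hΓ, hno⟩ := mem_filter.1 hΓ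
      exact bigPart_clusters ((mem_powerset.1 hΓ).trans hL') hno
    · intro P hP
      simp only [mem_filter, mem_setPartitions] at hP
      obtain ⟨⟨hPp, hadm, -⟩, hconn⟩ := hP
      exact clusters_bigPart hPp hadm hconn
    · intro Γ hΓ
      obtain ⟨-, hno⟩ := mem_filter.1 hΓ
      exact term_eq_prod_g1 hz hno
  rw [step2]
  have step3 : ∑ Γ ∈ L'.powerset.filter (NoIso adj L), term adj z L Γ = ∑ Γ ∈ L'.powerset, term adj z L Γ := by
    rw [← sum_filter_add_sum_filter_not L'.powerset (NoIso adj L) (term adj z L)]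
    have h0' : ∑ Γ ∈ L'.powerset.filter (fun Γ => ¬ NoIso adj L Γ), term adj z L Γ = 0 :=
      sum_eq_zero fun Γ hΓ => term_eq_zero_of_not_noIso hz ((mem_powerset.1 (mem_filter.1 hΓ).1).trans hL') (mem_filter.1 hΓ).2
    rw [h0', add_zero]
  rw [step3]
  have step4 : ∑ Γ ∈ L'.powerset, term adj z L Γ = (∑ Γ ∈ L'.powerset, term adj z L' Γ) * ∏ i ∈ L \ L', z {i} ∅ := by
    rw [sum_mul]
    exact sum_congr rfl fun Γ hΓ => term_eq_term_mul hL' (mem_powerset.1 hΓ)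
  rw [step4, hz.expansion' L']
  rfl

/-! ## §3 The corrected resummation (5.14.1): admissible fillings -/

/-- for a filling `κ` of Λ₁₂: no abutting between the interpolated polymers of `ρ` and of `κ` iff the interpolated cubes of `κ` lie in Λ₁₂′.
[cite: BalabanImbrieJaffe1988, (5.14.1) p.308] -/
theorem cross_iff_bigPart_subset {W : Finset ι} {ρ κ : Finset (Finset ι)} (hκ : IsSetPartition (lam12 W ρ) κ) :
    Cross adj ρ κ ↔ bigPart κ ⊆ lam12' adj W ρ := by
  constructor
  · intro hc i hi
    simp only [bigPart, mem_biUnion, mem_filter, id] at hi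
    obtain ⟨X', ⟨hX'κ, h2'⟩, hiX'⟩ := hi
    refine mem_filter.2 ⟨hκ.subset hX'κ hiX', fun j hj => ?_⟩
    simp only [bigPart, mem_biUnion, mem_filter, id] at hj
    obtain ⟨X, ⟨hXρ, h2⟩, hjX⟩ := hj
    exact hc X hXρ X' hX'κ h2 h2' j hjX i hiX'
  · intro hsub X hX X' hX' h2 h2' j hj j' hj'
    have hj'big : j' ∈ bigPart κ := by
      simp only [bigPart, mem_biUnion, mem_filter, id]
      exact ⟨X', ⟨hX', h2'⟩, hj'⟩
    have hjbig : j ∈ bigPart ρ := by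
      simp only [bigPart, mem_biUnion, mem_filter, id]
      exact ⟨X, ⟨hX, h2⟩, hj⟩
    exact (mem_filter.1 (hsub hj'big)).2 j hjbig

/-- **(5.14.1), CORRECTED BOOKKEEPING** (p. 308 [PDF 52]: *"To extract the perturbative terms, we resum the decoupling and Mayer expansions in
Λ₁₂^{(k)}. … Σ_{{X_α}} Π_α g₂(X_α) = Σ_{{X_α} overlapping Λ₁₁^{(k)c}} Π_α g₂(X_α) z_F(Λ₁₂^{(k)}) (5.14.1)"*): for cluster-factorizing corner
expectations and the fillings of (5.13.4) ranging over the CLUSTER CONFIGURATIONS (admissible set partitions, `BIJ88PolymerRep5134`), the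
resummation in Λ₁₂ gives
`Σ_{{X_α} admissible filling of W} Π_α g₁(X_α) = Σ_{{X_α} admissible, all overlapping B} Π_α g₁(X_α) · [z Λ₁₂′ Λ₁₂′ · Π_{i∈Λ₁₂∖Λ₁₂′} z{i}∅]`
— the inner factor being the expectation over the fields of Λ₁₂ with the cubes of Λ₁₂ that ABUT AN INTERPOLATED OUTER POLYMER decoupled
(`s_i = 0`), not the fully coupled `⟨…⟩_{1,Λ₁₂}` of the print (which is the all-set-partitions bookkeeping, GAPS G-C2-p25-03).
[cite: BalabanImbrieJaffe1988, (5.14.1) p.308] -/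
theorem eq5141_adm {z : Finset ι → Finset ι → R} (hz : IsClusterFactorizing adj z) (W B : Finset ι) :
    ∑ P ∈ (setPartitions W).filter (IsAdmissible adj), ∏ X ∈ P, g1 adj z X
      = ∑ ρ ∈ (outer W B).filter (IsAdmissible adj),
          (∏ X ∈ ρ, g1 adj z X) * (z (lam12' adj W ρ) (lam12' adj W ρ) * ∏ i ∈ lam12 W ρ \ lam12' adj W ρ, z {i} ∅) := by
  rw [sum_filter, sum_setPartitions_split W B, sum_filter]
  refine sum_congr rfl fun ρ hρ => ?_
  split_ifs with hadm
  · rw [← sum_adm_bigPart_subset hz (lam12'_subset adj W ρ), mul_sum, sum_filter]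
    refine sum_congr rfl fun κ hκ => ?_
    have hκp : IsSetPartition (lam12 W ρ) κ := mem_setPartitions.1 hκ
    have hd : Disjoint ρ κ := disjoint_of_outer_of_filling hρ hκp
    by_cases h : IsAdmissible adj κ ∧ bigPart κ ⊆ lam12' adj W ρ
    · have h' : IsAdmissible adj (ρ ∪ κ) :=
        (isAdmissible_union_iff hd).2 ⟨hadm, h.1, (cross_iff_bigPart_subset hκp).2 h.2⟩
      rw [if_pos h', if_pos h, prod_union hd]
    · have h' : ¬ IsAdmissible adj (ρ ∪ κ) := fun h' =>
        h ⟨((isAdmissible_union_iff hd).1 h').2.1, (cross_iff_bigPart_subset hκp).1 ((isAdmissible_union_iff hd).1 h').2.2⟩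
      rw [if_neg h', if_neg h]
  · refine sum_eq_zero fun κ hκ => ?_
    have hκp : IsSetPartition (lam12 W ρ) κ := mem_setPartitions.1 hκ
    rw [if_neg]
    intro h'
    exact hadm ((isAdmissible_union_iff (disjoint_of_outer_of_filling hρ hκp)).1 h').1

omit [DecidableRel adj] in
/-- the inner factor is an expectation over Λ₁₂: `z Λ₁₂′ Λ₁₂′ · Π_{i∈Λ₁₂∖Λ₁₂′} z{i}∅ = z Λ₁₂ Λ₁₂′` — the fields of Λ₁₂ with the parameter
corner `1` on Λ₁₂′ and `0` on the layer abutting the interpolated outer polymers. [cite: BalabanImbrieJaffe1988, (5.14.1) p.308] -/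
theorem inner_eq_corner {z : Finset ι → Finset ι → R} (hz : IsClusterFactorizing adj z) {L L' : Finset ι} (hL' : L' ⊆ L) :
    z L' L' * ∏ i ∈ L \ L', z {i} ∅ = z L L' := by
  have hcut : ∀ j ∈ L', ∀ j' ∈ L \ L', j ∈ L' → j' ∈ L' → ¬ adj j j' ∧ ¬ adj j' j :=
    fun j _ j' hj' _ hj'L' => absurd hj'L' (mem_sdiff.1 hj').2
  conv_rhs => rw [← union_sdiff_of_subset hL', hz.split L' (L \ L') L' disjoint_sdiff hcut]
  congr 1
  -- the layer `L ∖ L′` carries no active cube: it factorizes into single cubes with empty active set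
  rw [hz.prod_partition ((L \ L').image fun i => ({i} : Finset ι)) (L \ L') ?_ ?_]
  · rw [prod_image fun i _ j _ h => singleton_injective h]
    refine prod_congr rfl fun i hi => ?_
    rw [hz.local_inter {i} L', inter_singleton_of_notMem (mem_sdiff.1 hi).2]
  · refine ⟨fun P hP => ?_, fun h => ?_, fun v hv => ⟨{v}, mem_image_of_mem _ hv, mem_singleton_self v⟩, fun P hP Q hQ v hvP hvQ => ?_⟩
    · obtain ⟨i, hi, rfl⟩ := mem_image.1 hP
      exact singleton_subset_iff.2 hi
    · obtain ⟨i, -, hi⟩ := mem_image.1 h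
      exact singleton_ne_empty i hi
    · obtain ⟨i, -, rfl⟩ := mem_image.1 hP
      obtain ⟨j, -, rfl⟩ := mem_image.1 hQ
      rw [← mem_singleton.1 hvP, ← mem_singleton.1 hvQ]
  · intro K hK K' _ _ j hj j' _ hjL' _
    obtain ⟨i, hi, rfl⟩ := mem_image.1 hK
    rw [mem_singleton] at hj
    subst hj
    exact absurd hjL' (mem_sdiff.1 hi).2

/-- **(5.14.1) for `⟨Π_{i∈W} f(□_i)⟩_1` itself, corrected bookkeeping**: `z W W = Σ_{ρ admissible outer family} Π_{X∈ρ} g₁(X) · z Λ₁₂ Λ₁₂′`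
(combine `BIJ88PolymerRep5134.polymerRep` with `eq5141_adm` and `inner_eq_corner`). [cite: BalabanImbrieJaffe1988, (5.14.1) p.308] -/
theorem polymerRep_resummed {z : Finset ι → Finset ι → R} (hz : IsClusterFactorizing adj z) (W B : Finset ι) :
    z W W = ∑ ρ ∈ (outer W B).filter (IsAdmissible adj), (∏ X ∈ ρ, g1 adj z X) * z (lam12 W ρ) (lam12' adj W ρ) := by
  rw [polymerRep hz W, eq5141_adm hz W B]
  exact sum_congr rfl fun ρ _ => by rw [inner_eq_corner hz (lam12'_subset adj W ρ)]

end Literature.MathematicalPhysics.QuantumFieldTheory.BalabanImbrieJaffe1984to88.BIJ88Resummation5141Adm
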